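import Summits.QuantumFields.BalabanUV.Beta.GAN24.WardResidualRotatedVertex
import Summits.QuantumFields.BalabanUV.Beta.GAN24.WardResidualSRecursion

/-!
# `BalabanUV.Beta.GAN24.WardResidualRotatedVertexSlotWard` — binder row G-an2-4 ∕ (CONV-C), CT-W «WC-TL» → «QR-LL», R-gan24p1-g26-2 (ii) ∕ (ii-T) (the OWNER gan24-p1
# g26∕g27; p2's first refusal; leaf-01 g65's K-LL-4 (b3) prerequisite, W3 journal l.42703): **THE SLOT-WARD LAW OF THE ROTATED-VERTEX FAMILY** — the coarse divergence, in the
# SLOT, of `(ν, y′) ↦ dM (conjV K (diagK g)) N S M ν y′` (any `K`, any symbol `g`) and of the comb instance (α) (road-P2 chair `b2b-balaban-gan24-p2`, gen 39, INTENT 4)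

NOT IN PRINT; OUR BOOKKEEPING ([folklore] bookkeeping: an1's `KernelWardRelative.divV_vertexOfK` and leaf-10's `WardLocusSecondOrder.divV_vertexOfM_of_bdd` applied to the commutator
kernel, whose columns p2 g38's `colH_conjV_diagK ∕ colM_conjV_diagK` evaluate; the comb instance uses the column Ward laws (hH) `KernelWardHColumnWall.colH_ward_KInvStep_all` and
(hMw) `KernelWardMColumn.colM_coDressKBmAt_KInvStep_ward` BY NAME; 0 `def`, 0 cited fact, 0 `def … : Prop`, 0 sorry).  HONEST FRAMING (cell contract, verbatim): «discharging
`BetaPertH` makes Bałaban's UV stability UNCONDITIONAL — a real constructive-QFT result; it is NOT the continuum limit and NOT the Clay problem.»  HONEST DEPENDENCY (verbatim):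
«continuum YM on T⁴ ⇐ BetaPertH ∧ nine spine estimates (0/9 proved); BetaPertH ⇐ (D1) ∧ (D4) ∧ CAP+tail; G-an2-4 gates asym, D1 and NE2/3/4.»

WHAT.  `divV V y := Σ_μ (V μ (y − e_μ) − V μ y)` (an2's `KernelWard.divV`).
* §1 GENERIC (`K` decaying, `g` bounded, `S` local stencils, `M` bounded vertex table): **`divV_vertexOfK_conjV_diagK`**: `divV (ν y′ ↦ vertexOfK (conjV K (diagK g)) N S ν y′) y =
  Σ_κ wsum (u ↦ Σ_ν (g (N•(y−e_ν)) (inr ν)·colH K N ν (y−e_ν) κ u − g (N•y) (inr ν)·colH K N ν y κ u) − g u (inl κ)·Σ_ν (colH K N ν (y−e_ν) κ u − colH K N ν y κ u)) (S κ)` —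
  the SLOT symbol rides the boundary pair, the LEG symbol multiplies the column divergence; **`divV_vertexOfM_conjV_diagK`** (multiplier twin).
* §2 THE COMB INSTANCE (α) (`G_{j+1}`, `S_{j+1}`, `M1_{j+1}`, `X_{y₀} = diagK (½ Σ_v legInd ρ (Lc•y₀ + v))`, in-block root): **`divV_rotatedVertex_comb`** —
  `divV (ν y′ ↦ ½•dM (conjV G X_{y₀}) Lc S M ν y′) y = ½•[Σ_κ wsum (u ↦ ½Σ_ν (𝟙[y − e_ν = y₀]·colH G ν (y−e_ν) κ u − 𝟙[y = y₀]·colH G ν y κ u) − ½𝟙[blk u = y₀]·c_H·gaugeWt Lc y κ u) (S κ)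
  + Σ_ρ cwsum (w ↦ ½Σ_ν (𝟙[y − e_ν = y₀]·colM G ν (y−e_ν) ρ w − 𝟙[y = y₀]·colM G ν y ρ w)) (M ρ)]`, `c_H = (stepScale (j+1)·Lc^{d+1})⁻¹` — LOCAL in `y` about `y₀` (the slot
  indicator's boundary pair) plus ONE gauge-weighted FACE read of `S` restricted to `B(y₀)`; the multiplier column divergence drops by (hMw); NO commutator `conjV 𝕄 X` appears; **`divV_rotatedVertexEnd_comb`** — the (α⁺) twin (end-point indicators).
Asserts NO value of Bałaban's tables; discharges NOTHING of (S) ∕ (Q-R) ∕ (LT) ∕ (Q-L) ∕ (C) ∕ «T2Shape» ∕ «T2Drift» ∕ (hW, hWall); NEVER «G-an2-4 closed» as (CONV-C); NOT D1, NOT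
BetaPertH, NOT continuum, NOT Clay.  2026-08-22; no existing file touched.
-/

noncomputable section

open Finset
open scoped BigOperators
open Literature.MathematicalPhysics.QuantumFieldTheory
open Literature.MathematicalPhysics.QuantumFieldTheory.Balaban1983to89
open Literature.MathematicalPhysics.QuantumFieldTheory.Balaban1983to89.Beta
open B6BondElimination (unitVec)
open ExpKernelCalculus (Site MKer Decays VertexFamily)
open KernelWard (divV)
open AffineAveraging (box toSite)
open AveragingContours (blk)
open OneStepResolventKernel (Fib LocStencil wsum)
open OneStepKernelFamily (KInvStep colH vertexOfK)
open SecondOrderResponse (colM vertexOfM dM)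
open InterLevelTransport (cwsum cwsum_apply)
open Summit.QuantumFields.BalabanUV.Beta.BorderedHessian (diagK stepScale)
open Summit.QuantumFields.BalabanUV.Beta.ChartConjugation (conjV)
open Summit.QuantumFields.BalabanUV.Beta.ChartConjugationReflection (abs_le_of_locStencil)
open Summit.QuantumFields.BalabanUV.Beta.AveragingWardRootedStencils (legInd)
open Summit.QuantumFields.BalabanUV.Beta.AxialDressingRooted (coDressKBmAt decays_coDressKBmAt_KInvStep)
open Summit.QuantumFields.BalabanUV.Beta.SpineRooted (SpureRecAt M1At locStencil_SpureRecAt vertexFamily_M1At)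
open Summit.QuantumFields.BalabanUV.Beta.KernelWardRelative (gaugeWt divV_vertexOfK)
open Summit.QuantumFields.BalabanUV.Beta.KernelWardHColumnWall (colH_ward_KInvStep_all)
open Summit.QuantumFields.BalabanUV.Beta.KernelWardMColumn (colM_coDressKBmAt_KInvStep_ward divV_add)
open Summit.QuantumFields.BalabanUV.Beta.WardLocusSecondOrder (divV_vertexOfM_of_bdd)
open Summit.QuantumFields.BalabanUV.Beta.WardLocusResidualClass (abs_blockGen_le)
open Summit.QuantumFields.BalabanUV.Beta.GAN24.WardResidualLabelSums (decays_conjV_diagK)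
open Summit.QuantumFields.BalabanUV.Beta.GAN24.WardResidualRotatedVertex (colH_conjV_diagK colM_conjV_diagK blockGen_inl blockGen_zsmul_inr)

namespace Summit.QuantumFields.BalabanUV.Beta.GAN24.WardResidualRotatedVertexSlotWard

variable {d N : ℕ}

/-! ## §1 Generic: the slot divergence of the rotated vertex through a commutator -/

/-- [folklore] **SLOT DIVERGENCE OF THE CHAIN-RULE VERTEX THROUGH A COMMUTATOR** (any decaying `K`, bounded symbol `g`, local stencils `S`): the SLOT symbol value rides the
boundary pair of columns, the LEG symbol value multiplies the column divergence —
`divV (ν y′ ↦ vertexOfK (conjV K (diagK g)) N S ν y′) y = Σ_κ wsum (u ↦ Σ_ν (g (N•(y−e_ν)) (inr ν)·colH K N ν (y−e_ν) κ u − g (N•y) (inr ν)·colH K N ν y κ u)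
− g u (inl κ)·Σ_ν (colH K N ν (y−e_ν) κ u − colH K N ν y κ u)) (S κ)`. -/
theorem divV_vertexOfK_conjV_diagK {K : MKer (d + 1) (Fib d)} {C δ : ℝ} (hK : Decays K C δ) (hδ : 0 < δ)
    {g : Site (d + 1) → Fib d → ℝ} {Bg : ℝ} (hg : ∀ p c, |g p c| ≤ Bg)
    {S : Fin (d + 1) → Site (d + 1) → MKer (d + 1) (Fib d)} {Cs δs : ℝ} (hS : LocStencil S Cs δs) (hδs : 0 < δs) (y : Site (d + 1)) :
    divV (fun ν y' => vertexOfK (conjV K (diagK g)) N S ν y') y =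
      ∑ κ : Fin (d + 1), wsum (fun u => (∑ ν : Fin (d + 1), (g ((N : ℤ) • (y - unitVec ν)) (Sum.inr ν) * colH K N ν (y - unitVec ν) κ u
          - g ((N : ℤ) • y) (Sum.inr ν) * colH K N ν y κ u))
        - g u (Sum.inl κ) * ∑ ν : Fin (d + 1), (colH K N ν (y - unitVec ν) κ u - colH K N ν y κ u)) (S κ) := by
  have hKg := decays_conjV_diagK hK hg
  have hKg' : ∃ δ' C' : ℝ, 0 < δ' ∧ 0 ≤ C' ∧ Decays (conjV K (diagK g)) C' δ' := ⟨_, _, hδ, hKg.nonneg (Sum.inl 0), hKg⟩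
  rw [divV_vertexOfK (N := N) hKg' hS hδs y]
  refine Finset.sum_congr rfl fun κ _ => ?_
  congr 1
  funext u
  simp only [colH_conjV_diagK, Finset.mul_sum, ← Finset.sum_sub_distrib]
  refine Finset.sum_congr rfl fun ν _ => ?_
  ring

/-- [folklore] **SLOT DIVERGENCE OF THE MULTIPLIER VERTEX THROUGH A COMMUTATOR** (any decaying `K`, bounded symbol, bounded vertex table `M`):
`divV (ν y′ ↦ vertexOfM (conjV K (diagK g)) N M ν y′) y = Σ_ρ cwsum (w ↦ Σ_ν (g (N•(y−e_ν)) (inr ν)·colM K N ν (y−e_ν) ρ w − g (N•y) (inr ν)·colM K N ν y ρ w)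
− g (N•w) (inr ρ)·Σ_ν (colM K N ν (y−e_ν) ρ w − colM K N ν y ρ w)) (M ρ)`. -/
theorem divV_vertexOfM_conjV_diagK [NeZero N] {K : MKer (d + 1) (Fib d)} {C δ : ℝ} (hK : Decays K C δ) (hδ : 0 < δ)
    {g : Site (d + 1) → Fib d → ℝ} {Bg : ℝ} (hg : ∀ p c, |g p c| ≤ Bg)
    {M : Fin (d + 1) → Site (d + 1) → MKer (d + 1) (Fib d)} {BM : ℝ} (hM : ∀ ρ w x z a b, |M ρ w x z a b| ≤ BM) (y : Site (d + 1)) :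
    divV (fun ν y' => vertexOfM (conjV K (diagK g)) N M ν y') y = fun x z a b =>
      ∑ ρ : Fin (d + 1), cwsum N (fun w => (∑ ν : Fin (d + 1), (g ((N : ℤ) • (y - unitVec ν)) (Sum.inr ν) * colM K N ν (y - unitVec ν) ρ w
          - g ((N : ℤ) • y) (Sum.inr ν) * colM K N ν y ρ w))
        - g ((N : ℤ) • w) (Sum.inr ρ) * ∑ ν : Fin (d + 1), (colM K N ν (y - unitVec ν) ρ w - colM K N ν y ρ w)) (M ρ) x z a b := by
  have hKg := decays_conjV_diagK hK hg
  have hKg' : ∃ δ' C' : ℝ, 0 < δ' ∧ 0 ≤ C' ∧ Decays (conjV K (diagK g)) C' δ' := ⟨_, _, hδ, hKg.nonneg (Sum.inl 0), hKg⟩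
  rw [divV_vertexOfM_of_bdd (N := N) hKg' hM y]
  funext x z a b
  refine Finset.sum_congr rfl fun ρ _ => ?_
  congr 1
  funext w
  simp only [colM_conjV_diagK, Finset.mul_sum, ← Finset.sum_sub_distrib]
  refine Finset.sum_congr rfl fun ν _ => ?_
  ring


/-! ## §2 The comb instance: the slot-Ward law of the (α) family -/

section Comb

variable {Lc : ℕ} [NeZero Lc]

/-- NOT IN PRINT; OUR BOOKKEEPING.  **(ii-T)_α — THE SLOT-WARD LAW OF THE ROTATED-VERTEX FAMILY (α)** (`G = G_{j+1} = coDressKBmAt ρ Lc (KInvStep Lc (j+1))`, `S = SpureRecAt … (j+1)`,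
`M = M1At … (j+1)`, block generator `X_{y₀}` of an in-block root): the slot divergence of `(ν, y′) ↦ ½•dM (conjV G X_{y₀}) Lc S M ν y′` at the coarse site `y` is
`½·[Σ_κ wsum (u ↦ Σ_ν (½𝟙[y − e_ν = y₀]·colH G ν (y−e_ν) κ u − ½𝟙[y = y₀]·colH G ν y κ u) − ½𝟙[blk u = y₀]·c_H·gaugeWt Lc y κ u) (S κ)
 + Σ_ρ cwsum (w ↦ Σ_ν (½𝟙[y − e_ν = y₀]·colM G ν (y−e_ν) ρ w − ½𝟙[y = y₀]·colM G ν y ρ w)) (M ρ)]`, `c_H = (stepScale (j+1)·Lc^{d+1})⁻¹`: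
LOCAL in `y` about `y₀` (the slot indicator's boundary pair) plus ONE gauge-weighted read of `S` restricted to `B(y₀)` ((hH) `colH_ward_KInvStep_all`); the multiplier column
divergence VANISHES ((hMw) `colM_coDressKBmAt_KInvStep_ward`).  No commutator `conjV 𝕄 X` term: the (α) family is not slot-Ward-covariant. -/
theorem divV_rotatedVertex_comb (hLc : 1 ≤ Lc) {r : Fin (d + 1) → ℕ} (hr : r ∈ box (d + 1) Lc) (cE cVH cΛ : ℝ) (j : ℕ) (y₀ y : Site (d + 1)) :
    divV (fun ν y' => (1 / 2 : ℝ) • dM (conjV (coDressKBmAt (toSite r) Lc (KInvStep (d := d) Lc (j + 1)))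
        (diagK (((1 : ℝ) / 2) • ∑ v ∈ box (d + 1) Lc, legInd (toSite r) ((Lc : ℤ) • y₀ + toSite v)))) Lc
        (SpureRecAt d Lc (toSite r) cE cVH cΛ (j + 1)) (M1At d Lc (toSite r) cΛ (j + 1)) ν y') y
      = (1 / 2 : ℝ) • ((∑ κ : Fin (d + 1), wsum (fun u =>
            (∑ ν : Fin (d + 1), ((if y - unitVec ν = y₀ then (1 / 2 : ℝ) else 0) * colH (coDressKBmAt (toSite r) Lc (KInvStep (d := d) Lc (j + 1))) Lc ν (y - unitVec ν) κ u
              - (if y = y₀ then (1 / 2 : ℝ) else 0) * colH (coDressKBmAt (toSite r) Lc (KInvStep (d := d) Lc (j + 1))) Lc ν y κ u))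
            - (if blk Lc u = y₀ then (1 / 2 : ℝ) else 0) * ((stepScale d Lc (j + 1) * (Lc : ℝ) ^ (d + 1))⁻¹ * gaugeWt Lc y κ u))
            (SpureRecAt d Lc (toSite r) cE cVH cΛ (j + 1) κ))
        + fun x z a b => ∑ ρ : Fin (d + 1), cwsum Lc (fun w =>
            ∑ ν : Fin (d + 1), ((if y - unitVec ν = y₀ then (1 / 2 : ℝ) else 0) * colM (coDressKBmAt (toSite r) Lc (KInvStep (d := d) Lc (j + 1))) Lc ν (y - unitVec ν) ρ w
              - (if y = y₀ then (1 / 2 : ℝ) else 0) * colM (coDressKBmAt (toSite r) Lc (KInvStep (d := d) Lc (j + 1))) Lc ν y ρ w))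
            (M1At d Lc (toSite r) cΛ (j + 1) ρ) x z a b) := by
  obtain ⟨δG, CG, hδG, hCG, hG⟩ := decays_coDressKBmAt_KInvStep (d := d) hr (j + 1)
  have hg : ∀ p c, |(((1 : ℝ) / 2) • ∑ v ∈ box (d + 1) Lc, legInd (toSite r) ((Lc : ℤ) • y₀ + toSite v)) p c| ≤ |((1 : ℝ) / 2)| * (box (d + 1) Lc).card :=
    fun p c => abs_blockGen_le Lc (toSite r) _ y₀ p c
  obtain ⟨Cs, δs, hδs, hS⟩ := locStencil_SpureRecAt (d := d) (Lc := Lc) hLc hr cE cVH cΛ (j + 1)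
  have hM := vertexFamily_M1At (d := d) hLc hr cΛ (j + 1) (zero_le_one)
  have hMb : ∀ ρ w x z a b, |M1At d Lc (toSite r) cΛ (j + 1) ρ w x z a b| ≤ _ := fun ρ w x z a b => KernelWard.bdd_of_biLoc (hM ρ w) zero_le_one x z a b
  -- split the family: `½ • (vertexOfK + vertexOfM)`, divergence is additive and homogeneous
  have e1 : (fun ν y' => (1 / 2 : ℝ) • dM (conjV (coDressKBmAt (toSite r) Lc (KInvStep (d := d) Lc (j + 1)))
        (diagK (((1 : ℝ) / 2) • ∑ v ∈ box (d + 1) Lc, legInd (toSite r) ((Lc : ℤ) • y₀ + toSite v)))) Lc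
        (SpureRecAt d Lc (toSite r) cE cVH cΛ (j + 1)) (M1At d Lc (toSite r) cΛ (j + 1)) ν y')
      = fun ν y' => (1 / 2 : ℝ) • vertexOfK (conjV (coDressKBmAt (toSite r) Lc (KInvStep (d := d) Lc (j + 1)))
          (diagK (((1 : ℝ) / 2) • ∑ v ∈ box (d + 1) Lc, legInd (toSite r) ((Lc : ℤ) • y₀ + toSite v)))) Lc (SpureRecAt d Lc (toSite r) cE cVH cΛ (j + 1)) ν y'
        + (1 / 2 : ℝ) • vertexOfM (conjV (coDressKBmAt (toSite r) Lc (KInvStep (d := d) Lc (j + 1)))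
          (diagK (((1 : ℝ) / 2) • ∑ v ∈ box (d + 1) Lc, legInd (toSite r) ((Lc : ℤ) • y₀ + toSite v)))) Lc (M1At d Lc (toSite r) cΛ (j + 1)) ν y' := by
    funext ν y'; unfold SecondOrderResponse.dM; rw [smul_add]
  rw [e1, divV_add]
  have hsmul : ∀ (V : Fin (d + 1) → Site (d + 1) → MKer (d + 1) (Fib d)), divV (fun ν y' => (1 / 2 : ℝ) • V ν y') y = (1 / 2 : ℝ) • divV V y := by
    intro V; simp only [KernelWard.divV, Finset.smul_sum, smul_sub]
  rw [hsmul, hsmul, ← smul_add, divV_vertexOfK_conjV_diagK (N := Lc) hG hδG hg hS hδs y, divV_vertexOfM_conjV_diagK (N := Lc) hG hδG hg hMb y]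
  -- evaluate the symbol and the two column Ward laws
  simp only [blockGen_inl hLc, blockGen_zsmul_inr hr, colH_ward_KInvStep_all hr (j + 1), colM_coDressKBmAt_KInvStep_ward, mul_zero, sub_zero]


/-- NOT IN PRINT; OUR BOOKKEEPING.  **(ii-T)_{α⁺} — THE SLOT-WARD LAW OF THE END-POINT ROTATED-VERTEX FAMILY (α⁺)** (`X⁺_{y₀} = diagK g⁺`, `g⁺(z,c) = g(z + step c, c)`, p2 g39's
`WardResidualRotatedVertexInversion.rotatedVertexEnd_eq`): the same law with the END-point indicators `𝟙[y − e_ν + e_ν = y₀] = 𝟙[y = y₀]` ∕ `𝟙[y + e_ν = y₀]` on the boundary pair and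
`𝟙[blk (u + e_κ) = y₀]` on the leg weight. -/
theorem divV_rotatedVertexEnd_comb (hLc : 1 ≤ Lc) {r : Fin (d + 1) → ℕ} (hr : r ∈ box (d + 1) Lc) (cE cVH cΛ : ℝ) (j : ℕ) (y₀ y : Site (d + 1)) :
    divV (fun ν y' => (1 / 2 : ℝ) • dM (conjV (coDressKBmAt (toSite r) Lc (KInvStep (d := d) Lc (j + 1)))
        (diagK (fun z c => (((1 : ℝ) / 2) • ∑ v ∈ box (d + 1) Lc, legInd (toSite r) ((Lc : ℤ) • y₀ + toSite v))
          (z + Sum.elim (fun κ => (Pi.single κ 1 : Site (d + 1))) (fun μ => (Lc : ℤ) • (Pi.single μ 1 : Site (d + 1))) c) c))) Lc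
        (SpureRecAt d Lc (toSite r) cE cVH cΛ (j + 1)) (M1At d Lc (toSite r) cΛ (j + 1)) ν y') y
      = (1 / 2 : ℝ) • ((∑ κ : Fin (d + 1), wsum (fun u =>
            (∑ ν : Fin (d + 1), ((if y - unitVec ν + Pi.single ν 1 = y₀ then (1 / 2 : ℝ) else 0)
                * colH (coDressKBmAt (toSite r) Lc (KInvStep (d := d) Lc (j + 1))) Lc ν (y - unitVec ν) κ u
              - (if y + Pi.single ν 1 = y₀ then (1 / 2 : ℝ) else 0) * colH (coDressKBmAt (toSite r) Lc (KInvStep (d := d) Lc (j + 1))) Lc ν y κ u))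
            - (if blk Lc (u + Pi.single κ 1) = y₀ then (1 / 2 : ℝ) else 0) * ((stepScale d Lc (j + 1) * (Lc : ℝ) ^ (d + 1))⁻¹ * gaugeWt Lc y κ u))
            (SpureRecAt d Lc (toSite r) cE cVH cΛ (j + 1) κ))
        + fun x z a b => ∑ ρ : Fin (d + 1), cwsum Lc (fun w =>
            ∑ ν : Fin (d + 1), ((if y - unitVec ν + Pi.single ν 1 = y₀ then (1 / 2 : ℝ) else 0)
                * colM (coDressKBmAt (toSite r) Lc (KInvStep (d := d) Lc (j + 1))) Lc ν (y - unitVec ν) ρ w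
              - (if y + Pi.single ν 1 = y₀ then (1 / 2 : ℝ) else 0) * colM (coDressKBmAt (toSite r) Lc (KInvStep (d := d) Lc (j + 1))) Lc ν y ρ w))
            (M1At d Lc (toSite r) cΛ (j + 1) ρ) x z a b) := by
  obtain ⟨δG, CG, hδG, hCG, hG⟩ := decays_coDressKBmAt_KInvStep (d := d) hr (j + 1)
  have hg : ∀ p c, |(fun z c => (((1 : ℝ) / 2) • ∑ v ∈ box (d + 1) Lc, legInd (toSite r) ((Lc : ℤ) • y₀ + toSite v))
      (z + Sum.elim (fun κ => (Pi.single κ 1 : Site (d + 1))) (fun μ => (Lc : ℤ) • (Pi.single μ 1 : Site (d + 1))) c) c) p c|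
      ≤ |((1 : ℝ) / 2)| * (box (d + 1) Lc).card := fun p c => abs_blockGen_le Lc (toSite r) _ y₀ _ c
  obtain ⟨Cs, δs, hδs, hS⟩ := locStencil_SpureRecAt (d := d) (Lc := Lc) hLc hr cE cVH cΛ (j + 1)
  have hM := vertexFamily_M1At (d := d) hLc hr cΛ (j + 1) (zero_le_one)
  have hMb : ∀ ρ w x z a b, |M1At d Lc (toSite r) cΛ (j + 1) ρ w x z a b| ≤ _ := fun ρ w x z a b => KernelWard.bdd_of_biLoc (hM ρ w) zero_le_one x z a b
  have hshift : ∀ (w : Site (d + 1)) (μ : Fin (d + 1)), (Lc : ℤ) • w + (Lc : ℤ) • (Pi.single μ 1 : Site (d + 1)) = (Lc : ℤ) • (w + Pi.single μ 1) := fun w μ => by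
    rw [smul_add]
  have e1 : (fun ν y' => (1 / 2 : ℝ) • dM (conjV (coDressKBmAt (toSite r) Lc (KInvStep (d := d) Lc (j + 1)))
        (diagK (fun z c => (((1 : ℝ) / 2) • ∑ v ∈ box (d + 1) Lc, legInd (toSite r) ((Lc : ℤ) • y₀ + toSite v))
          (z + Sum.elim (fun κ => (Pi.single κ 1 : Site (d + 1))) (fun μ => (Lc : ℤ) • (Pi.single μ 1 : Site (d + 1))) c) c))) Lc
        (SpureRecAt d Lc (toSite r) cE cVH cΛ (j + 1)) (M1At d Lc (toSite r) cΛ (j + 1)) ν y')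
      = fun ν y' => (1 / 2 : ℝ) • vertexOfK (conjV (coDressKBmAt (toSite r) Lc (KInvStep (d := d) Lc (j + 1)))
          (diagK (fun z c => (((1 : ℝ) / 2) • ∑ v ∈ box (d + 1) Lc, legInd (toSite r) ((Lc : ℤ) • y₀ + toSite v))
            (z + Sum.elim (fun κ => (Pi.single κ 1 : Site (d + 1))) (fun μ => (Lc : ℤ) • (Pi.single μ 1 : Site (d + 1))) c) c)))
          Lc (SpureRecAt d Lc (toSite r) cE cVH cΛ (j + 1)) ν y'
        + (1 / 2 : ℝ) • vertexOfM (conjV (coDressKBmAt (toSite r) Lc (KInvStep (d := d) Lc (j + 1)))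
          (diagK (fun z c => (((1 : ℝ) / 2) • ∑ v ∈ box (d + 1) Lc, legInd (toSite r) ((Lc : ℤ) • y₀ + toSite v))
            (z + Sum.elim (fun κ => (Pi.single κ 1 : Site (d + 1))) (fun μ => (Lc : ℤ) • (Pi.single μ 1 : Site (d + 1))) c) c)))
          Lc (M1At d Lc (toSite r) cΛ (j + 1)) ν y' := by
    funext ν y'; unfold SecondOrderResponse.dM; rw [smul_add]
  rw [e1, divV_add]
  have hsmul : ∀ (V : Fin (d + 1) → Site (d + 1) → MKer (d + 1) (Fib d)), divV (fun ν y' => (1 / 2 : ℝ) • V ν y') y = (1 / 2 : ℝ) • divV V y := by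
    intro V; simp only [KernelWard.divV, Finset.smul_sum, smul_sub]
  rw [hsmul, hsmul, ← smul_add, divV_vertexOfK_conjV_diagK (N := Lc) hG hδG hg hS hδs y, divV_vertexOfM_conjV_diagK (N := Lc) hG hδG hg hMb y]
  simp only [Sum.elim_inl, Sum.elim_inr, hshift, blockGen_inl hLc, blockGen_zsmul_inr hr, colH_ward_KInvStep_all hr (j + 1), colM_coDressKBmAt_KInvStep_ward,
    mul_zero, sub_zero]

end Comb

end Summit.QuantumFields.BalabanUV.Beta.GAN24.WardResidualRotatedVertexSlotWard

end
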